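import Literature.Topology.FourManifolds.SchoenfliesSphereTwoHolds
import Literature.Topology.FourManifolds.SchoenfliesBallSide
import Literature.Topology.FourManifolds.ImmersionCriterion
import HarnessLib

/-!
# A circle on an embedded `2`-sphere splits it into two smooth discs

Topic `Literature/Topology/FourManifolds` (fact seat of the Schoenflies theorem in `S³`,
`SphereEmbedding.schoenflies_exists_ambientIsotopy_image_eq_sphereEquator` /
`SphereEmbedding.schoenflies_exists_ball`, `SchoenfliesSphereThree.lean`; Schultens,
*Introduction to 3-Manifolds* (2014), Thm. 3.2.5).  **Everything in this file is proved; no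
definition and no named fact is introduced.**

In Alexander's proof of Thm. 3.2.5 (Schultens (2014), PDF p. 45) an innermost level circle `α`
of the embedded sphere `S ⊂ ℝ³` "separates `S` into two disks, `D₁`, `D₂`. Set `S₁ = D ∪ D₁`
and `S₂ = D ∪ D₂`."  This is the smooth two-dimensional Schoenflies theorem *on the sphere `S`
itself*; the tree has it on the round sphere `S²`
(`SphereHypersurfaceSides.IsSidePackage.nonempty_diffeomorph_closedBall_sides_holds`,
`SchoenfliesSphereTwoHolds.lean`), and this file carries it over to an arbitrary smoothly
embedded sphere `f : 𝕊² → N`: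

* `SphereCircleSplitting.exists_lift` — **lifting a circle through an embedding**: a smooth
  embedding `γ : 𝕊¹ → N` with `γ(𝕊¹) ⊆ f(𝕊²)` is `f ∘ γ'` for a smooth embedding
  `γ' : 𝕊¹ → 𝕊²` (the left inverse of `f` is smooth on `f(𝕊²)`,
  `contMDiffOn_leftInverse_of_isImmersion`, and the immersion criterion);
* `SphereCircleSplitting.exists_two_discs` — **the circle splits the sphere into two smooth
  discs**: there are smooth embeddings `e₁, e₂ : ℝ² → 𝕊²` with
  `e₁(𝕊¹) = e₂(𝕊¹) = γ'(𝕊¹)`, `e₁(𝔻²) ∪ e₂(𝔻²) = 𝕊²`, `e₁(𝔻²) ∩ e₂(𝔻²) = γ'(𝕊¹)`, the open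
  discs `e₁(𝔹²)`, `e₂(𝔹²)` being the two components of `𝕊² ∖ γ'(𝕊¹)`, and a prescribed point
  off the circle lying in `e₁(𝔹²)`; hence `f(𝕊²) = f(e₁(𝔻²)) ∪ f(e₂(𝔻²))` with
  `f(e₁(𝔻²)) ∩ f(e₂(𝔻²)) = γ(𝕊¹)` (`image_union_eq_range`, `image_inter_eq_range`).

## References

* J. Schultens, *Introduction to 3-Manifolds*, GSM 151, AMS (2014), proof of Thm. 3.2.5 (PDF
  p. 45 of the held copy `book:schultens2014-introduction-3-manifolds`). [Schultens2014]
* J. M. Lee, *Introduction to Smooth Manifolds*, 2nd ed. (2013), Thm. 4.14 / Prop. 5.2 (left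
  inverses of embeddings), Thm. 4.25. [LeeSmoothManifolds2013]
-/

open scoped Manifold ContDiff Topology
open Set Function Metric Module Filter

noncomputable section

namespace Literature.Topology.FourManifolds

namespace SphereCircleSplitting

variable {EN : Type*} [NormedAddCommGroup EN] [NormedSpace ℝ EN]
  {N : Type*} [TopologicalSpace N] [ChartedSpace EN N]

/-! ### §1 Lifting a circle through an embedding of the sphere -/

/-- **Lifting an embedded circle through an embedded sphere.**  If `f : 𝕊² → N` and
`γ : 𝕊¹ → N` are smooth embeddings into a boundaryless manifold with `γ(𝕊¹) ⊆ f(𝕊²)`, then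
`γ = f ∘ γ'` for a (unique) smooth embedding `γ' : 𝕊¹ → 𝕊²`: `γ' = g ∘ γ` for the left inverse
`g` of `f`, smooth on `f(𝕊²)` (`contMDiffOn_leftInverse_of_isImmersion`), with injective
differential because `dγ = df ∘ dγ'` (immersion criterion
`isSmoothEmbedding_of_injective_of_injective_mfderiv`).
[cite: LeeSmoothManifolds2013, Thm. 4.14 and Prop. 5.2] -/
theorem exists_lift {f : sphere (0 : EuclideanSpace ℝ (Fin (1 + 1 + 1))) 1 → N}
    (hf : Manifold.IsSmoothEmbedding (𝓡 (1 + 1)) 𝓘(ℝ, EN) ∞ f)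
    {γ : sphere (0 : EuclideanSpace ℝ (Fin (1 + 1))) 1 → N}
    (hγ : Manifold.IsSmoothEmbedding (𝓡 1) 𝓘(ℝ, EN) ∞ γ) (hγf : range γ ⊆ range f) :
    ∃ γ' : sphere (0 : EuclideanSpace ℝ (Fin (1 + 1))) 1 →
        sphere (0 : EuclideanSpace ℝ (Fin (1 + 1 + 1))) 1,
      Manifold.IsSmoothEmbedding (𝓡 1) (𝓡 (1 + 1)) ∞ γ' ∧ f ∘ γ' = γ := by
  haveI : Nonempty (sphere (0 : EuclideanSpace ℝ (Fin (1 + 1 + 1))) 1) := inferInstance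
  have hfinj : Injective f := hf.isEmbedding.injective
  set g : N → sphere (0 : EuclideanSpace ℝ (Fin (1 + 1 + 1))) 1 := invFun f with hgdef
  have hgf : LeftInverse g f := leftInverse_invFun hfinj
  have hg : ContMDiffOn 𝓘(ℝ, EN) (𝓡 (1 + 1)) ∞ g (range f) :=
    contMDiffOn_leftInverse_of_isImmersion hf.isImmersion hf.isEmbedding hgf
  set γ' := g ∘ γ with hγ'def
  have hfγ' : f ∘ γ' = γ := by
    funext x
    obtain ⟨y, hy⟩ := hγf (mem_range_self x)
    simp only [comp_apply, hγ'def, ← hy, hgf y]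
  have hγ'c : ContMDiff (𝓡 1) (𝓡 (1 + 1)) ∞ γ' :=
    hg.comp_contMDiff hγ.contMDiff fun x => hγf (mem_range_self x)
  have hγ'inj : Injective γ' := by
    intro x y hxy
    have := congrArg f hxy
    rw [show f (γ' x) = γ x from congrFun hfγ' x, show f (γ' y) = γ y from congrFun hfγ' y]
      at this
    exact hγ.isEmbedding.injective this
  refine ⟨γ', isSmoothEmbedding_of_injective_of_injective_mfderiv hγ'c
    (by exact_mod_cast le_top) hγ'inj fun x => ?_, hfγ'⟩
  have h1 : MDifferentiableAt (𝓡 1) (𝓡 (1 + 1)) γ' x := (hγ'c x).mdifferentiableAt (by simp)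
  have h2 : MDifferentiableAt (𝓡 (1 + 1)) 𝓘(ℝ, EN) f (γ' x) :=
    (hf.contMDiff (γ' x)).mdifferentiableAt (by simp)
  have hcomp := mfderiv_comp x h2 h1
  rw [hfγ'] at hcomp
  have hinj : Injective (mfderiv (𝓡 1) 𝓘(ℝ, EN) γ x) :=
    injective_mfderiv_of_isImmersionAt' (hγ.isImmersion.isImmersionAt x)
  rw [hcomp] at hinj
  exact Injective.of_comp hinj

/-! ### §2 The two discs -/

/-- **A smooth circle in `S²` splits it into two smoothly embedded closed discs**, with a
prescribed point off the circle inside the first: for a smooth embedding `γ' : 𝕊¹ → 𝕊²` and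
`x₀ ∉ γ'(𝕊¹)` there are smooth embeddings `e₁, e₂ : ℝ² → 𝕊²` with
`e₁(𝕊¹) = e₂(𝕊¹) = γ'(𝕊¹)`, `e₁(𝔻²) ∪ e₂(𝔻²) = 𝕊²`, `e₁(𝔻²) ∩ e₂(𝔻²) = γ'(𝕊¹)`,
`e₁(𝔹²) ∩ e₂(𝔹²) = ∅`, `x₀ ∈ e₁(𝔹²)`, and `e₁(𝔹²)`, `e₂(𝔹²)` the connected components of the
complement of the circle (side package of `SphereHypersurfaceSides.lean`; both closed sides are
smooth discs, `IsSidePackage.nonempty_diffeomorph_closedBall_sides_holds`; a disc side is an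
embedded ball, `IsSidePackage.exists_ball_of_diffeomorph_regularSublevel`).  Schultens (2014),
proof of Thm. 3.2.5: "Here `α` separates `S` into two disks, `D₁`, `D₂`."
[cite: Schultens2014, proof of Thm. 3.2.5 (PDF p. 45)] -/
theorem exists_two_discs_sphere
    {γ' : sphere (0 : EuclideanSpace ℝ (Fin (1 + 1))) 1 →
      sphere (0 : EuclideanSpace ℝ (Fin (1 + 1 + 1))) 1}
    (hγ' : Manifold.IsSmoothEmbedding (𝓡 1) (𝓡 (1 + 1)) ∞ γ')
    {x₀ : sphere (0 : EuclideanSpace ℝ (Fin (1 + 1 + 1))) 1} (hx₀ : x₀ ∉ range γ') :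
    ∃ e₁ e₂ : EuclideanSpace ℝ (Fin (1 + 1)) → sphere (0 : EuclideanSpace ℝ (Fin (1 + 1 + 1))) 1,
      Manifold.IsSmoothEmbedding (𝓡 (1 + 1)) (𝓡 (1 + 1)) ∞ e₁ ∧
      Manifold.IsSmoothEmbedding (𝓡 (1 + 1)) (𝓡 (1 + 1)) ∞ e₂ ∧
      e₁ '' sphere 0 1 = range γ' ∧ e₂ '' sphere 0 1 = range γ' ∧
      e₁ '' closedBall 0 1 ∪ e₂ '' closedBall 0 1 = univ ∧
      e₁ '' closedBall 0 1 ∩ e₂ '' closedBall 0 1 = range γ' ∧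
      Disjoint (e₁ '' ball 0 1) (e₂ '' ball 0 1) ∧ x₀ ∈ e₁ '' ball 0 1 ∧
      (∀ x ∈ e₁ '' ball 0 1, connectedComponentIn (range γ')ᶜ x = e₁ '' ball 0 1) ∧
      (∀ x ∈ e₂ '' ball 0 1, connectedComponentIn (range γ')ᶜ x = e₂ '' ball 0 1) := by
  obtain ⟨g, hg, hgx₀⟩ :=
    SphereHypersurfaceSides.exists_isSidePackage_neg (m := 1) le_rfl hγ' hx₀
  have hZ : (range γ').Nonempty := range_nonempty γ'
  obtain ⟨⟨Ψ₁⟩, -⟩ := hg.nonempty_diffeomorph_closedBall_sides_holds hZ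
  obtain ⟨⟨Ψ₂⟩, -⟩ := hg.neg.nonempty_diffeomorph_closedBall_sides_holds hZ
  obtain ⟨p, hp⟩ := hg.isConnected_pos.nonempty
  obtain ⟨e₁, he₁, he₁S, he₁D, -⟩ := hg.exists_ball_of_diffeomorph_regularSublevel Ψ₁ hp
  obtain ⟨e₂, he₂, he₂S, he₂D, -⟩ :=
    hg.neg.exists_ball_of_diffeomorph_regularSublevel Ψ₂ (p := x₀) (by simpa using hgx₀)
  have hZg : range γ' = g ⁻¹' {0} := hg.preimage_zero.symm
  have he₁B : e₁ '' ball 0 1 = {z | g z < 0} := by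
    rw [← closedBall_sdiff_sphere, image_sdiff he₁.isEmbedding.injective, he₁D, he₁S, hZg]
    ext z
    simp only [Set.mem_sdiff, mem_setOf_eq, mem_preimage, mem_singleton_iff]
    exact ⟨fun h => lt_of_le_of_ne h.1 h.2, fun h => ⟨h.le, h.ne⟩⟩
  have he₂B : e₂ '' ball 0 1 = {z | 0 < g z} := by
    rw [← closedBall_sdiff_sphere, image_sdiff he₂.isEmbedding.injective, he₂D, he₂S, hZg]
    ext z
    simp only [Set.mem_sdiff, mem_setOf_eq, mem_preimage, mem_singleton_iff, neg_nonpos]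
    exact ⟨fun h => lt_of_le_of_ne h.1 (Ne.symm h.2), fun h => ⟨h.le, h.ne'⟩⟩
  have he₂D' : e₂ '' closedBall 0 1 = {z | 0 ≤ g z} := by rw [he₂D]; ext z; simp
  refine ⟨e₁, e₂, he₁, he₂, he₁S, he₂S, ?_, ?_, ?_, ?_, ?_, ?_⟩
  · rw [he₁D, he₂D', eq_univ_iff_forall]
    exact fun z => (le_total (g z) 0).imp id id
  · rw [he₁D, he₂D', hZg]
    ext z
    simp only [mem_inter_iff, mem_setOf_eq, mem_preimage, mem_singleton_iff]
    exact ⟨fun h => le_antisymm h.1 h.2, fun h => ⟨h.le, h.ge⟩⟩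
  · rw [he₁B, he₂B]
    exact Set.disjoint_left.2 fun z (h1 : g z < 0) (h2 : 0 < g z) => lt_asymm h1 h2
  · rw [he₁B]; exact hgx₀
  · intro x hx
    rw [he₁B] at hx ⊢
    exact hg.connectedComponentIn_eq_neg hx
  · intro x hx
    rw [he₂B] at hx ⊢
    exact hg.connectedComponentIn_eq_pos hx

/-- **A smooth circle on a smoothly embedded `2`-sphere splits it into two smooth discs.**  For
smooth embeddings `f : 𝕊² → N`, `γ : 𝕊¹ → N` into a boundaryless manifold with
`γ(𝕊¹) ⊆ f(𝕊²)`, and a point `f x₀ ∉ γ(𝕊¹)`, there are a lift `γ'` of `γ` and smooth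
embeddings `e₁, e₂ : ℝ² → 𝕊²` as in `exists_two_discs_sphere`; consequently
`f(𝕊²) = f(e₁(𝔻²)) ∪ f(e₂(𝔻²))` and `f(e₁(𝔻²)) ∩ f(e₂(𝔻²)) = γ(𝕊¹)` — the discs `D₁`, `D₂`
of Schultens (2014), proof of Thm. 3.2.5 (PDF p. 45): "Here `α` separates `S` into two disks,
`D₁`, `D₂`. Set `S₁ = D ∪ D₁` and `S₂ = D ∪ D₂`."
[cite: Schultens2014, proof of Thm. 3.2.5 (PDF p. 45)] -/
theorem exists_two_discs {f : sphere (0 : EuclideanSpace ℝ (Fin (1 + 1 + 1))) 1 → N}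
    (hf : Manifold.IsSmoothEmbedding (𝓡 (1 + 1)) 𝓘(ℝ, EN) ∞ f)
    {γ : sphere (0 : EuclideanSpace ℝ (Fin (1 + 1))) 1 → N}
    (hγ : Manifold.IsSmoothEmbedding (𝓡 1) 𝓘(ℝ, EN) ∞ γ) (hγf : range γ ⊆ range f)
    {x₀ : sphere (0 : EuclideanSpace ℝ (Fin (1 + 1 + 1))) 1} (hx₀ : f x₀ ∉ range γ) :
    ∃ (γ' : sphere (0 : EuclideanSpace ℝ (Fin (1 + 1))) 1 →
        sphere (0 : EuclideanSpace ℝ (Fin (1 + 1 + 1))) 1)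
      (e₁ e₂ : EuclideanSpace ℝ (Fin (1 + 1)) →
        sphere (0 : EuclideanSpace ℝ (Fin (1 + 1 + 1))) 1),
      Manifold.IsSmoothEmbedding (𝓡 1) (𝓡 (1 + 1)) ∞ γ' ∧ f ∘ γ' = γ ∧
      Manifold.IsSmoothEmbedding (𝓡 (1 + 1)) (𝓡 (1 + 1)) ∞ e₁ ∧
      Manifold.IsSmoothEmbedding (𝓡 (1 + 1)) (𝓡 (1 + 1)) ∞ e₂ ∧
      e₁ '' sphere 0 1 = range γ' ∧ e₂ '' sphere 0 1 = range γ' ∧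
      e₁ '' closedBall 0 1 ∪ e₂ '' closedBall 0 1 = univ ∧
      e₁ '' closedBall 0 1 ∩ e₂ '' closedBall 0 1 = range γ' ∧
      Disjoint (e₁ '' ball 0 1) (e₂ '' ball 0 1) ∧ x₀ ∈ e₁ '' ball 0 1 ∧
      f '' (e₁ '' closedBall 0 1) ∪ f '' (e₂ '' closedBall 0 1) = range f ∧
      f '' (e₁ '' closedBall 0 1) ∩ f '' (e₂ '' closedBall 0 1) = range γ ∧
      f '' (e₁ '' sphere 0 1) = range γ := by
  obtain ⟨γ', hγ', hfγ'⟩ := exists_lift hf hγ hγf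
  have hx₀' : x₀ ∉ range γ' := by
    rintro ⟨t, rfl⟩
    exact hx₀ ⟨t, (congrFun hfγ' t).symm⟩
  obtain ⟨e₁, e₂, he₁, he₂, he₁S, he₂S, hU, hI, hdisj, hx₀B, -, -⟩ :=
    exists_two_discs_sphere hγ' hx₀'
  have hfinj : Injective f := hf.isEmbedding.injective
  have hrange : range γ = f '' range γ' := by rw [← hfγ', range_comp]
  refine ⟨γ', e₁, e₂, hγ', hfγ', he₁, he₂, he₁S, he₂S, hU, hI, hdisj, hx₀B, ?_, ?_, ?_⟩
  · rw [← image_union, hU, image_univ]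
  · rw [← image_inter hfinj, hI, hrange]
  · rw [he₁S, hrange]

end SphereCircleSplitting

end Literature.Topology.FourManifolds

end
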